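import Summits.HodgeConjecture.HodgeConjecture.Theorems.F0P3cStCharTSVanDijkWeylSymm    -- ★ `vanDijkWeight_eq_of_isUnit` (LH6-p01's `dite` → the ★ (4.9.4) tokens); brings `TorusDefs`, `F0P2oBorelTorusModulus`, `twistModule_cmLocal_eq`
import Summits.HodgeConjecture.HodgeConjecture.Theorems.F0P3cStCharTSTorusCompactPart  -- ★ `mem_unitsIntegers_iff`, `valued_apply_eq_one_of_mem_normOneUnits` (`M_c = 𝒪ˣ × E¹`, one place above a non-split `v`)
import Literature.NumberTheory.Automorphic.LocalRingUnitModulusProduct                 -- ★ `unitModulusChar_localRing_eq_prod` (`‖u‖ = ∏_{w∣v} |u_w|_w`)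
import Literature.NumberTheory.Automorphic.AddCharConductorExponent                    -- ★ `normAbs_add_le_max`, `normAbs_neg`, `normAbs_le_normAbs_iff_valued`
import Literature.NumberTheory.Automorphic.CMPrincipalSeriesSpherical                  -- ★ `unitModulusChar_eq_one_of_forall_v_eq_one`
import HarnessLib

/-!
# F0 · P3c · line LH6 «StCharTS» — brick «SHELL-WEIGHT★»: VAN DIJK'S WEIGHT ON THE SHELLS OF THE SPLIT TORUS,
# `Δ(ι(α, z)) = max(‖α‖, ‖α‖⁻¹)` off the compact part `M_c`  [Rogawski1990, §12.7 L. 12.7.2 (proof) p. 193; §4.9 (4.9.4) p. 56; §12.2 p. 173]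

Cell `pub/hodgecm-mathlib`, crux H413 = `stmt-HodgeConjecture-24833` (lane `--supports … --as helper`), route HCCMUnconditional; seat LH1-p03 (g2) as
extra hands of line LH6, DEAL «SHELL-WEIGHT★» named by LH6-p01 (g2) 2026-09-02T06:04:41Z (desk F0P3-plan (g14) routing 06:00:10Z), consumer: the
shell decomposition of the torus side of ★ (4.9.4) (`vanDijkWeight` must be CONSTANT on the shells `m₀ · M_c` and NON-ZERO off `M_c`).  THEOREMS ONLY
(no definition, no instance, no notation, no named fact, no `sorry`); ★-only imports.  HONEST LABEL: HC_CM is proved only modulo the 7 printed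
citations (2 remaining: hLiu418 = stmt-HodgeConjecture-24832, h413 = stmt-HodgeConjecture-24833) until rung 0 closes; (TOR)-road plumbing,
count-neutral, closes nothing by itself.

THE MATHEMATICS.  `v` a finite place of `L⁺` NON-SPLIT in the CM field `L` (`hns`: the one place `w ∣ v` is fixed by `c`), `R = L_w` (`= LocalRing L v`),
`σ = c̄ ⊗ 1`, `‖·‖ = unitModulusChar R = |·|_w` (★ `unitModulusChar_localRing_eq_prod`).  LH6-p01's chart `ι : M = Rˣ × E¹ → T`, `ι(α, z) = d(α, z σ(α) α⁻¹, σ(α)⁻¹)`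
(★ `torusChart`, `torusChartEntries`), compact part `M_c = 𝒪ˣ × E¹` (★ `F0P3cStCharTSTorusCompactPart` §4).  For `m = (α, z) ∉ M_c`, i.e. `q := ‖α‖ ≠ 1`:
* the regular scalars of `t = ι m` are `a = d₀⁻¹d₁ = z σ(α) α⁻²` and `b = d₀⁻¹d₂ = (σ(α) α)⁻¹`, of modules `‖a‖ = q⁻¹`, `‖b‖ = q⁻²` (`|z|_w = |σ(α)/α|_w = 1`);
* all triangles are isosceles: `‖a − 1‖ = max(q⁻¹, 1)` and `‖b − 1‖ = max(q⁻², 1)`, in particular both are UNITS (`t` is regular in the sense of ★ `vanDijkWeight`);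
* `Δ(t) = δ_B^{1∕2}(t) · ‖a − 1‖ · √‖b − 1‖` (★ `vanDijkWeight_eq_of_isUnit`, ★ `twistModule_cmLocal_eq`, ★ `rootDeltaChar_cmBorel_torus`: `δ_B^{1∕2}(t) = ‖d₀‖ = q`)
  `= q · max(q⁻¹, 1)² = max(q, q⁻¹)` — **`vanDijkWeight_torusChart_of_not_mem`** (print: `Δ(m) = |D_G(m)|`, and for `‖α‖ = q_w^{-n}`, `n ≠ 0`, `|D_G| = q_w^{|n|}`).
Hence `Δ ∘ ι` is constant on every shell `m₀ M_c` off `M_c` (**`vanDijkWeight_torusChart_mul_of_mem`**, `‖·‖ ≡ 1` on `𝒪ˣ`, ★ `unitModulusChar_eq_one_of_forall_v_eq_one`)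
and non-zero there (**`vanDijkWeight_torusChart_ne_zero`**), `≥ 1` indeed.

## References
* [Rogawski1990] J. D. Rogawski, *Automorphic Representations of Unitary Groups in Three Variables*, Ann. of Math. Stud. 123 (1990): §4.9 (4.9.4) p. 56; §12.2 p. 173; §12.7 L. 12.7.2 p. 193.
* [vanDijk1972] G. van Dijk, *Computation of certain induced characters of 𝔭-adic groups*, Math. Ann. 199 (1972), Thm. p. 237.
* [WeilBNT1967] A. Weil, *Basic Number Theory* (1967), Ch. I §2 (the module of a local field, ultrametric inequality).
-/

set_option autoImplicit false
-- the mandated namespace has the single-problem summit's repeated segment (`HodgeConjecture.HodgeConjecture`)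
set_option linter.dupNamespace false

noncomputable section
open NumberField IsDedekindDomain MeasureTheory Topology
open scoped Matrix MatrixGroups NNReal
open Literature.NumberTheory.Rogawski1990 Literature.NumberTheory.Automorphic Literature.NumberTheory.Automorphic.UnitaryGroup
open Literature.NumberTheory.Automorphic.UnitaryGroup.HeisRing
open Literature.NumberTheory.GaloisRepresentations Literature.NumberTheory.GaloisRepresentations.IsNonarchimedeanLocalField

namespace Summit.HodgeConjecture.HodgeConjecture.Cruxes.H413.F0P3cStCharTSShellWeight

open F0P3cStCharTSTorusDefs F0P3cStCharTSTorusCompactPart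

/-! ## §1 All triangles are isosceles: `‖x − 1‖ = max(‖x‖, 1)` for `‖x‖ ≠ 1` in a non-archimedean local field -/

section Ultrametric

variable {F : Type*} [Field F] [ValuativeRel F] [TopologicalSpace F] [IsNonarchimedeanLocalField F]

/-- **`‖x − 1‖ = max(‖x‖, 1)` when `‖x‖ ≠ 1`** (normalised absolute value of a non-archimedean local field: the ultrametric inequality ★ `normAbs_add_le_max`
is an equality when the two sides have different size). [cite: WeilBNT1967, Ch. I §2] -/
theorem normAbs_sub_one_eq_max {x : F} (hx : normAbs F x ≠ 1) : normAbs F (x - 1) = max (normAbs F x) 1 := by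
  have hle : normAbs F (x - 1) ≤ max (normAbs F x) 1 := by
    have h := normAbs_add_le_max x (-1 : F)
    rwa [← sub_eq_add_neg, normAbs_neg, map_one] at h
  have hx' : normAbs F x ≤ max (normAbs F (x - 1)) 1 := by
    have h := normAbs_add_le_max (x - 1) (1 : F)
    rwa [sub_add_cancel, map_one] at h
  have h1' : (1 : ℝ≥0) ≤ max (normAbs F x) (normAbs F (x - 1)) := by
    have h := normAbs_add_le_max x (-(x - 1))
    rwa [← sub_eq_add_neg, sub_sub_cancel, map_one, normAbs_neg] at h
  refine le_antisymm hle ?_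
  rcases lt_or_gt_of_ne hx with hlt | hgt
  · rw [max_eq_right hlt.le]
    exact (le_max_iff.1 h1').resolve_left (not_le.2 hlt)
  · rw [max_eq_left hgt.le]
    exact (le_max_iff.1 hx').resolve_right (not_le.2 hgt)

end Ultrametric

section OnePlace
variable {L : Type} [Field L] [NumberField L] (w : HeightOneSpectrum (𝓞 L))

/-- `|x|_w = |y|_w` (canonical valuation of `L_w`) ⟹ `‖x‖ = ‖y‖` (normalised absolute value). [cite: WeilBNT1967, Ch. I §2] -/
theorem normAbs_eq_of_valued_eq {x y : w.adicCompletion L} (h : Valued.v x = Valued.v y) :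
    normAbs (w.adicCompletion L) x = normAbs (w.adicCompletion L) y :=
  le_antisymm ((normAbs_le_normAbs_iff_valued w x y).2 h.le) ((normAbs_le_normAbs_iff_valued w y x).2 h.ge)

/-- `|x|_w = 1 ⟹ ‖x‖ = 1`. [cite: WeilBNT1967, Ch. I §2] -/
theorem normAbs_eq_one_of_valued_eq_one {x : w.adicCompletion L} (h : Valued.v x = 1) : normAbs (w.adicCompletion L) x = 1 := by
  rw [← map_one (normAbs (w.adicCompletion L))]
  exact normAbs_eq_of_valued_eq w (h.trans (map_one _).symm)

/-- `‖x‖ = 1 ⟹ |x|_w = 1`. [cite: WeilBNT1967, Ch. I §2] -/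
theorem valued_eq_one_of_normAbs_eq_one {x : w.adicCompletion L} (h : normAbs (w.adicCompletion L) x = 1) : Valued.v x = 1 := by
  have h1 : Valued.v x ≤ Valued.v (1 : w.adicCompletion L) := (normAbs_le_normAbs_iff_valued w x 1).1 (by rw [h, map_one])
  have h2 : Valued.v (1 : w.adicCompletion L) ≤ Valued.v x := (normAbs_le_normAbs_iff_valued w 1 x).1 (by rw [h, map_one])
  rw [map_one] at h1 h2
  exact le_antisymm h1 h2

end OnePlace

/-! ## §1b Scalar bookkeeping in `ℝ≥0` -/
/-- `q ≠ 1 ⟹ q⁻¹ ≠ 1` in `ℝ≥0`. [cite: Rogawski1990, §12.7 L. 12.7.2 (proof) p. 193] -/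
theorem inv_ne_one_of_ne_one {q : ℝ≥0} (hq1 : q ≠ 1) : q⁻¹ ≠ 1 := fun h => hq1 (inv_eq_one.1 h)
/-- `q ≠ 1 ⟹ q⁻¹ · q⁻¹ ≠ 1` in `ℝ≥0`. [cite: Rogawski1990, §12.7 L. 12.7.2 (proof) p. 193] -/
theorem inv_mul_inv_ne_one_of_ne_one {q : ℝ≥0} (hq1 : q ≠ 1) : q⁻¹ * q⁻¹ ≠ 1 := by
  intro h
  rw [← mul_inv, inv_eq_one, ← pow_two] at h
  exact hq1 ((pow_eq_one_iff_of_nonneg zero_le two_ne_zero).1 h)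
/-- `√(max(q⁻¹ · q⁻¹, 1)) = max(q⁻¹, 1)` in `ℝ≥0`. [cite: Rogawski1990, §12.7 L. 12.7.2 (proof) p. 193] -/
theorem sqrt_max_inv_mul_inv_one (q : ℝ≥0) : NNReal.sqrt (max (q⁻¹ * q⁻¹) 1) = max q⁻¹ 1 := by
  rw [NNReal.sqrt.monotone.map_max, NNReal.sqrt_mul_self, NNReal.sqrt_one]
/-- Scalar bookkeeping in `ℝ≥0 → ℝ → ℂ`: `q · ((max(q⁻¹,1) · max(q⁻¹,1))⁻¹)⁻¹ = max(q, q⁻¹)` for `q ≠ 0`. [cite: Rogawski1990, §12.7 L. 12.7.2 (proof) p. 193] -/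
theorem shellWeight_scalar_aux (q : ℝ≥0) (hq : q ≠ 0) :
    (((q : ℝ≥0) : ℝ) : ℂ) * ((((max q⁻¹ 1 * max q⁻¹ 1)⁻¹ : ℝ≥0) : ℝ) : ℂ)⁻¹ = (((max q q⁻¹ : ℝ≥0) : ℝ) : ℂ) := by
  have h : q * (max q⁻¹ 1 * max q⁻¹ 1) = max q q⁻¹ := by
    rcases le_total q 1 with h1 | h1
    · have hi : 1 ≤ q⁻¹ := (one_le_inv₀ (pos_iff_ne_zero.2 hq)).2 h1
      rw [max_eq_left hi, max_eq_right (h1.trans hi), ← mul_assoc, mul_inv_cancel₀ hq, one_mul]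
    · have hi : q⁻¹ ≤ 1 := inv_le_one_of_one_le₀ h1
      rw [max_eq_right hi, max_eq_left (hi.trans h1), mul_one, mul_one]
  rw [NNReal.coe_inv, Complex.ofReal_inv, inv_inv, ← Complex.ofReal_mul, ← NNReal.coe_mul, h]

/-! ## §2 The regular scalars of `ι(α, z)` at a non-split place: modules, isosceles triangles, units -/

section CM

variable (L : Type) [Field L] [NumberField L] [IsCMField L] (v : HeightOneSpectrum (𝓞 ↥(maximalRealSubfield L)))
  (hns : ∀ w : PlacesOver L v, IsCMField.complexConj L • w.1 = w.1)

/-- Second coordinate of the chart: `torusEntry 1 (ι(α, z)) = z σ(α) α⁻¹`. [cite: Rogawski1990, §12.2 p. 173] -/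
theorem torusEntry_one_torusChart (m : (LocalRing L v)ˣ × ↥(normOneUnits (conjLocal L (IsCMField.complexConj L) v))) :
    torusEntry (conjLocal L (IsCMField.complexConj L) v) (cmLocalForm L 3 v) 1 (torusChart L v m) =
      (m.2 : (LocalRing L v)ˣ) * Units.map ((conjLocal L (IsCMField.complexConj L) v : LocalRing L v →+* LocalRing L v) : LocalRing L v →* LocalRing L v) m.1 * m.1⁻¹ := by
  rw [torusEntry_torusChart]; rfl

/-- Third coordinate of the chart: `torusEntry 2 (ι(α, z)) = σ(α)⁻¹`. [cite: Rogawski1990, §12.2 p. 173] -/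
theorem torusEntry_two_torusChart (m : (LocalRing L v)ˣ × ↥(normOneUnits (conjLocal L (IsCMField.complexConj L) v))) :
    torusEntry (conjLocal L (IsCMField.complexConj L) v) (cmLocalForm L 3 v) 2 (torusChart L v m) =
      (Units.map ((conjLocal L (IsCMField.complexConj L) v : LocalRing L v →+* LocalRing L v) : LocalRing L v →* LocalRing L v) m.1)⁻¹ := by
  rw [torusEntry_torusChart]; rfl

/-- **`‖α‖ = |α_w|_w`** at a non-split `v` (one place `w` above `v`; ★ `unitModulusChar_localRing_eq_prod`). [cite: WeilBNT1967, Ch. I §2] [cite: Rogawski1990, §12.2 p. 173] -/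
theorem unitModulusChar_eq_normAbs (w : PlacesOver L v) (hw : IsCMField.complexConj L • w.1 = w.1) (u : (LocalRing L v)ˣ) :
    unitModulusChar (LocalRing L v) u = normAbs (w.1.adicCompletion L) ((u : LocalRing L v) w) := by
  haveI := PlacesOver.subsingleton_of_smul_eq (IsCMField.complexConj L) (IsCMField.complexConj_ne_one L) w hw
  rw [unitModulusChar_localRing_eq_prod]
  exact Fintype.prod_subsingleton _ w

/-- `|σ(α)_w|_w = |α_w|_w` in `‖·‖`-currency at a non-split place (★ `conjLocal_apply_eq_of_smul_eq`, ★ `valued_galAdicCompletionMap`). [cite: Rogawski1990, §12.2 p. 173] -/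
theorem normAbs_conjLocal_apply (w : PlacesOver L v) (hw : IsCMField.complexConj L • w.1 = w.1) (x : LocalRing L v) :
    normAbs (w.1.adicCompletion L) (conjLocal L (IsCMField.complexConj L) v x w) = normAbs (w.1.adicCompletion L) (x w) := by
  refine normAbs_eq_of_valued_eq w.1 ?_
  rw [conjLocal_apply_eq_of_smul_eq (IsCMField.complexConj L) (IsCMField.complexConj_ne_one L) v w hw, valued_galAdicCompletionMap]

include hns in
/-- **`|z_w|_w = 1` in `‖·‖`-currency** for `z ∈ E¹_v` at a non-split place (★ `valued_apply_eq_one_of_mem_normOneUnits`). [cite: Rogawski1990, §12.2 p. 173] -/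
theorem normAbs_apply_eq_one_of_mem_normOneUnits (w : PlacesOver L v) (z : ↥(normOneUnits (conjLocal L (IsCMField.complexConj L) v))) :
    normAbs (w.1.adicCompletion L) (((z : (LocalRing L v)ˣ) : LocalRing L v) w) = 1 :=
  normAbs_eq_one_of_valued_eq_one w.1 (valued_apply_eq_one_of_mem_normOneUnits L v hns z.2 w)

omit [IsCMField L] in
/-- A unit of `R = ∏ L_w` has non-zero components: `|u_w| ≠ 0` in `‖·‖`-currency. [cite: WeilBNT1967, Ch. I §2] -/
theorem normAbs_apply_ne_zero (w : PlacesOver L v) (u : (LocalRing L v)ˣ) : normAbs (w.1.adicCompletion L) ((u : LocalRing L v) w) ≠ 0 := by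
  have h : (u : LocalRing L v) w * ((u⁻¹ : (LocalRing L v)ˣ) : LocalRing L v) w = 1 := by
    rw [← Pi.mul_apply, Units.mul_inv, Pi.one_apply]
  exact (map_ne_zero (normAbs (w.1.adicCompletion L))).2 (left_ne_zero_of_mul_eq_one h)

include hns in
/-- **THE MODULE OF THE FIRST REGULAR SCALAR: `|a_w|_w = ‖α‖⁻¹`**, `a = d₀⁻¹d₁ = z σ(α) α⁻²` for `t = ι(α, z)`. [cite: Rogawski1990, §12.7 L. 12.7.2 (proof) p. 193; §12.2 p. 173] -/
theorem normAbs_regularScalar_fst (w : PlacesOver L v) (m : (LocalRing L v)ˣ × ↥(normOneUnits (conjLocal L (IsCMField.complexConj L) v))) :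
    normAbs (w.1.adicCompletion L)
        ((((torusEntry (conjLocal L (IsCMField.complexConj L) v) (cmLocalForm L 3 v) 0 (torusChart L v m))⁻¹ *
          torusEntry (conjLocal L (IsCMField.complexConj L) v) (cmLocalForm L 3 v) 1 (torusChart L v m) : (LocalRing L v)ˣ) : LocalRing L v) w) =
      (normAbs (w.1.adicCompletion L) ((m.1 : LocalRing L v) w))⁻¹ := by
  rw [torusEntry_zero_torusChart, torusEntry_one_torusChart]
  -- `α · a · α = z · σ(α)` in `Rˣ`
  have hu : m.1 * (m.1⁻¹ * ((m.2 : (LocalRing L v)ˣ) *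
      Units.map ((conjLocal L (IsCMField.complexConj L) v : LocalRing L v →+* LocalRing L v) : LocalRing L v →* LocalRing L v) m.1 * m.1⁻¹)) * m.1 =
      (m.2 : (LocalRing L v)ˣ) * Units.map ((conjLocal L (IsCMField.complexConj L) v : LocalRing L v →+* LocalRing L v) : LocalRing L v →* LocalRing L v) m.1 := by
    rw [mul_inv_cancel_left, inv_mul_cancel_right]
  have hR : (m.1 : LocalRing L v) w *
      (((m.1⁻¹ * ((m.2 : (LocalRing L v)ˣ) *
        Units.map ((conjLocal L (IsCMField.complexConj L) v : LocalRing L v →+* LocalRing L v) : LocalRing L v →* LocalRing L v) m.1 * m.1⁻¹) :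
          (LocalRing L v)ˣ) : LocalRing L v) w) * (m.1 : LocalRing L v) w =
      ((m.2 : (LocalRing L v)ˣ) : LocalRing L v) w * conjLocal L (IsCMField.complexConj L) v (m.1 : LocalRing L v) w :=
    congr_fun (congrArg (fun u : (LocalRing L v)ˣ => (u : LocalRing L v)) hu) w
  have hN := congrArg (normAbs (w.1.adicCompletion L)) hR
  rw [map_mul, map_mul, map_mul, normAbs_conjLocal_apply L v w (hns w), normAbs_apply_eq_one_of_mem_normOneUnits L v hns w m.2, one_mul,
    mul_assoc] at hN
  -- `q · (x · q) = q · 1` with `q ≠ 0`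
  have hq := normAbs_apply_ne_zero L v w m.1
  exact eq_inv_of_mul_eq_one_left (mul_left_cancel₀ hq (hN.trans (mul_one _).symm))

include hns in
/-- **THE MODULE OF THE SECOND REGULAR SCALAR: `|b_w|_w = ‖α‖⁻²`**, `b = d₀⁻¹d₂ = (σ(α) α)⁻¹` for `t = ι(α, z)`. [cite: Rogawski1990, §12.7 L. 12.7.2 (proof) p. 193; §12.2 p. 173] -/
theorem normAbs_regularScalar_snd (w : PlacesOver L v) (m : (LocalRing L v)ˣ × ↥(normOneUnits (conjLocal L (IsCMField.complexConj L) v))) :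
    normAbs (w.1.adicCompletion L)
        ((((torusEntry (conjLocal L (IsCMField.complexConj L) v) (cmLocalForm L 3 v) 0 (torusChart L v m))⁻¹ *
          torusEntry (conjLocal L (IsCMField.complexConj L) v) (cmLocalForm L 3 v) 2 (torusChart L v m) : (LocalRing L v)ˣ) : LocalRing L v) w) =
      (normAbs (w.1.adicCompletion L) ((m.1 : LocalRing L v) w))⁻¹ * (normAbs (w.1.adicCompletion L) ((m.1 : LocalRing L v) w))⁻¹ := by
  rw [torusEntry_zero_torusChart, torusEntry_two_torusChart]
  -- `σ(α) · α · b = 1` in `Rˣ`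
  have hu : Units.map ((conjLocal L (IsCMField.complexConj L) v : LocalRing L v →+* LocalRing L v) : LocalRing L v →* LocalRing L v) m.1 * m.1 *
      (m.1⁻¹ * (Units.map ((conjLocal L (IsCMField.complexConj L) v : LocalRing L v →+* LocalRing L v) : LocalRing L v →* LocalRing L v) m.1)⁻¹) = 1 := by
    rw [mul_assoc, mul_inv_cancel_left, mul_inv_cancel]
  have hR : conjLocal L (IsCMField.complexConj L) v (m.1 : LocalRing L v) w * (m.1 : LocalRing L v) w *
      (((m.1⁻¹ * (Units.map ((conjLocal L (IsCMField.complexConj L) v : LocalRing L v →+* LocalRing L v) : LocalRing L v →* LocalRing L v) m.1)⁻¹ :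
          (LocalRing L v)ˣ) : LocalRing L v) w) = 1 :=
    congr_fun (congrArg (fun u : (LocalRing L v)ˣ => (u : LocalRing L v)) hu) w
  have hN := congrArg (normAbs (w.1.adicCompletion L)) hR
  rw [map_mul, map_mul, map_one, normAbs_conjLocal_apply L v w (hns w)] at hN
  exact (eq_inv_of_mul_eq_one_left ((mul_comm _ _).trans hN)).trans (mul_inv _ _)

/-- **`m ∉ M_c ⟺ ‖α‖ ≠ 1`** (`M_c = 𝒪ˣ × E¹` as the ★ SUBGROUP term of (SHF′) ∕ ★ `F0P3cStCharTSTorusCompactPart` §4, membership in the subgroup; ★ `mem_unitsIntegers_iff`; one place above `v`). [cite: Rogawski1990, §12.2 p. 173; §12.7 L. 12.7.2 (proof) p. 193] -/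
theorem not_mem_torusCompactPart_iff (w : PlacesOver L v) (hw : IsCMField.complexConj L • w.1 = w.1)
    (m : (LocalRing L v)ˣ × ↥(normOneUnits (conjLocal L (IsCMField.complexConj L) v))) :
    m ∉ (((Submonoid.pi Set.univ (fun w : PlacesOver L v => (w.1.adicCompletionIntegers L).toSubring.toSubmonoid)).units.prod (⊤ : Subgroup ↥(normOneUnits (conjLocal L (IsCMField.complexConj L) v)))) : Subgroup ((LocalRing L v)ˣ × ↥(normOneUnits (conjLocal L (IsCMField.complexConj L) v)))) ↔
      unitModulusChar (LocalRing L v) m.1 ≠ 1 := by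
  haveI := PlacesOver.subsingleton_of_smul_eq (IsCMField.complexConj L) (IsCMField.complexConj_ne_one L) w hw
  rw [Subgroup.mem_prod, mem_unitsIntegers_iff, unitModulusChar_eq_normAbs L v w hw]
  simp only [Subgroup.mem_top, and_true]
  constructor
  · intro h hn
    exact h fun w' => (Subsingleton.elim w w') ▸ valued_eq_one_of_normAbs_eq_one w.1 hn
  · intro h hv
    exact h (normAbs_eq_one_of_valued_eq_one w.1 (hv w))

include hns in
/-- **OFF `M_c` THE CHART IS REGULAR** in the sense of ★ `vanDijkWeight`: both `a − 1 = d₀⁻¹d₁ − 1` and `b − 1 = d₀⁻¹d₂ − 1` are units of `R`, of modules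
`|(a − 1)_w|_w = max(‖α‖⁻¹, 1)` and `|(b − 1)_w|_w = max(‖α‖⁻², 1)`. [cite: Rogawski1990, §12.7 L. 12.7.2 (proof) p. 193; §12.5 p. 182] -/
theorem isUnit_regularScalars_torusChart_of_not_mem (m : (LocalRing L v)ˣ × ↥(normOneUnits (conjLocal L (IsCMField.complexConj L) v)))
    (hm : m ∉ (((Submonoid.pi Set.univ (fun w : PlacesOver L v => (w.1.adicCompletionIntegers L).toSubring.toSubmonoid)).units.prod (⊤ : Subgroup ↥(normOneUnits (conjLocal L (IsCMField.complexConj L) v)))) : Subgroup ((LocalRing L v)ˣ × ↥(normOneUnits (conjLocal L (IsCMField.complexConj L) v))))) :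
    IsUnit ((((torusEntry (conjLocal L (IsCMField.complexConj L) v) (cmLocalForm L 3 v) 0 (torusChart L v m))⁻¹ *
        torusEntry (conjLocal L (IsCMField.complexConj L) v) (cmLocalForm L 3 v) 1 (torusChart L v m) : (LocalRing L v)ˣ) : LocalRing L v) - 1) ∧
      IsUnit ((((torusEntry (conjLocal L (IsCMField.complexConj L) v) (cmLocalForm L 3 v) 0 (torusChart L v m))⁻¹ *
        torusEntry (conjLocal L (IsCMField.complexConj L) v) (cmLocalForm L 3 v) 2 (torusChart L v m) : (LocalRing L v)ˣ) : LocalRing L v) - 1) := by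
  obtain ⟨w⟩ : Nonempty (PlacesOver L v) := inferInstance
  haveI := PlacesOver.subsingleton_of_smul_eq (IsCMField.complexConj L) (IsCMField.complexConj_ne_one L) w (hns w)
  have hq1 : normAbs (w.1.adicCompletion L) ((m.1 : LocalRing L v) w) ≠ 1 := by
    rw [← unitModulusChar_eq_normAbs L v w (hns w)]; exact (not_mem_torusCompactPart_iff L v w (hns w) m).1 hm
  -- a Pi-element with non-zero components (one place!) is a unit
  have key : ∀ x : LocalRing L v, normAbs (w.1.adicCompletion L) (x w) ≠ 1 → IsUnit (x - 1) := by
    intro x hx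
    have hne : ∀ w' : PlacesOver L v, (x - 1) w' ≠ 0 := by
      intro w'
      obtain rfl : w = w' := Subsingleton.elim w w'
      intro h0
      have h1 := normAbs_sub_one_eq_max hx
      rw [Pi.sub_apply, Pi.one_apply] at h0
      rw [h0, map_zero] at h1
      exact (lt_of_lt_of_le zero_lt_one (le_max_right _ _)).ne h1
    exact isUnit_iff_exists_inv.2 ⟨fun w' => ((x - 1) w')⁻¹, funext fun w' => mul_inv_cancel₀ (hne w')⟩
  refine ⟨key _ ?_, key _ ?_⟩
  · rw [normAbs_regularScalar_fst L v hns w m]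
    exact inv_ne_one_of_ne_one hq1
  · rw [normAbs_regularScalar_snd L v hns w m]
    exact inv_mul_inv_ne_one_of_ne_one hq1

/-! ## §3 The head: `Δ(ι(α, z)) = max(‖α‖, ‖α‖⁻¹)` off `M_c`; constant on shells; non-zero -/


/-- **ONE-PLACE CLOSED FORM OF THE ★ (4.9.4) WEIGHT, in its tokens: `δ_B^{1∕2}(t)·(‖a−1‖⁻¹·χ⁻(b−1)⁻¹)⁻¹ = |d₀|_w · ((|a − 1|_w · √|b − 1|_w)⁻¹)⁻¹`** (non-split `v`,
the one place `w ∣ v`; ANY diagonal writing `d` of `t ∈ T` with `a − 1 = d₀⁻¹d₁ − 1`, `b − 1 = d₀⁻¹d₂ − 1` units): the twist module by ★ `twistModule_cmLocal_eq_prod_normAbs`,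
`δ_B^{1∕2}(t) = ‖d₀‖` by ★ `rootDeltaChar_cmBorel_torus`, the products over `{w}` collapsed (★ `unitModulusChar_localRing_eq_prod`). [cite: Rogawski1990, §12.7 L. 12.7.2 (proof)
p. 193; §4.9 (4.9.4) p. 56] [cite: vanDijk1972, Thm. p. 237] -/
theorem weightTokens_eq_normAbs (w : PlacesOver L v) (hw : IsCMField.complexConj L • w.1 = w.1) (t : ↥(cmBorelTriple L 3 v).M)
    (d : Fin 3 → (LocalRing L v)ˣ)
    (hd : glDiagonal 3 (LocalRing L v) d = ((t : ↥(unitaryGroupOfForm (conjLocal L (IsCMField.complexConj L) v) (cmLocalForm L 3 v))) : GL (Fin 3) (LocalRing L v)))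
    (ha : IsUnit ((((d 0)⁻¹ * d 1 : (LocalRing L v)ˣ) : LocalRing L v) - 1))
    (hb : IsUnit ((((d 0)⁻¹ * d 2 : (LocalRing L v)ˣ) : LocalRing L v) - 1)) :
    (haveI := locallyCompactSpace_cmBorelU L 3 v;
      ((rootDeltaChar (cmBorelTriple L 3 v).P
          ⟨(t : ↥(unitaryGroupOfForm (conjLocal L (IsCMField.complexConj L) v) (cmLocalForm L 3 v))), (cmBorelTriple L 3 v).M_le t.2⟩ : ℂˣ) : ℂ) *
        (((letI : MeasurableSpace (LocalRing L v) := borel _; haveI : BorelSpace (LocalRing L v) := ⟨rfl⟩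
          haveI : SecondCountableTopology (LocalRing L v) := secondCountableTopology_localRing (E := L) v
          ((distribHaarChar (LocalRing L v) ha.unit)⁻¹ *
            (HeisRing.skewModulus (conjLocal L (IsCMField.complexConj L) v) (continuous_conjLocal L (IsCMField.complexConj L) v) hb.unit
              (HeisRing.map_unit_torusCentralScalar_sub_one (conjLocal L (IsCMField.complexConj L) v) (cmLocalForm_eq_over L 3 v) t hd hb))⁻¹ :
                ℝ≥0)) : ℝ) : ℂ)⁻¹) =
      (((normAbs (w.1.adicCompletion L) ((d 0 : LocalRing L v) w) : ℝ≥0) : ℝ) : ℂ) *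
        ((((normAbs (w.1.adicCompletion L) ((((d 0)⁻¹ * d 1 : (LocalRing L v)ˣ) : LocalRing L v) w - 1) *
            NNReal.sqrt (normAbs (w.1.adicCompletion L) ((((d 0)⁻¹ * d 2 : (LocalRing L v)ˣ) : LocalRing L v) w - 1)))⁻¹ : ℝ≥0) : ℝ) : ℂ)⁻¹ := by
  haveI := locallyCompactSpace_cmBorelU L 3 v
  -- the twist module in `∏_{w∣v} |·|_w`-currency (★ `twistModule_cmLocal_eq_prod_normAbs`)
  have key : (letI : MeasurableSpace (LocalRing L v) := borel _; haveI : BorelSpace (LocalRing L v) := ⟨rfl⟩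
      haveI : SecondCountableTopology (LocalRing L v) := secondCountableTopology_localRing (E := L) v
      ((distribHaarChar (LocalRing L v) ha.unit)⁻¹ *
        (HeisRing.skewModulus (conjLocal L (IsCMField.complexConj L) v) (continuous_conjLocal L (IsCMField.complexConj L) v) hb.unit
          (HeisRing.map_unit_torusCentralScalar_sub_one (conjLocal L (IsCMField.complexConj L) v) (cmLocalForm_eq_over L 3 v) t hd hb))⁻¹ : ℝ≥0)) =
      ((∏ w : PlacesOver L v, normAbs (w.1.adicCompletion L) (((((d 0)⁻¹ * d 1 : (LocalRing L v)ˣ) : LocalRing L v) - 1) w)) *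
        NNReal.sqrt (∏ w : PlacesOver L v, normAbs (w.1.adicCompletion L) (((((d 0)⁻¹ * d 2 : (LocalRing L v)ˣ) : LocalRing L v) - 1) w)))⁻¹ :=
    twistModule_cmLocal_eq_prod_normAbs L v t.2 hd ha hb
  -- `δ_B^{1∕2}(t) = ‖d₀‖`
  have hδ : ((rootDeltaChar (cmBorelTriple L 3 v).P
        ⟨(t : ↥(unitaryGroupOfForm (conjLocal L (IsCMField.complexConj L) v) (cmLocalForm L 3 v))), (cmBorelTriple L 3 v).M_le t.2⟩ : ℂˣ) : ℂ) =
      ((unitModulusChar (LocalRing L v) (d 0) : ℝ≥0) : ℝ) := by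
    rw [← torusEntry_eq_of_glDiagonal_eq (conjLocal L (IsCMField.complexConj L) v) (cmLocalForm L 3 v) 0 t d hd]
    exact F0P2oBorelTorusModulus.rootDeltaChar_cmBorel_torus L v t
  -- one place: the products collapse
  have hPA : (∏ w' : PlacesOver L v, normAbs (w'.1.adicCompletion L) (((((d 0)⁻¹ * d 1 : (LocalRing L v)ˣ) : LocalRing L v) - 1) w')) =
      normAbs (w.1.adicCompletion L) ((((d 0)⁻¹ * d 1 : (LocalRing L v)ˣ) : LocalRing L v) w - 1) := by
    haveI := PlacesOver.subsingleton_of_smul_eq (IsCMField.complexConj L) (IsCMField.complexConj_ne_one L) w hw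
    rw [Fintype.prod_subsingleton _ w, Pi.sub_apply, Pi.one_apply]
  have hPB : (∏ w' : PlacesOver L v, normAbs (w'.1.adicCompletion L) (((((d 0)⁻¹ * d 2 : (LocalRing L v)ˣ) : LocalRing L v) - 1) w')) =
      normAbs (w.1.adicCompletion L) ((((d 0)⁻¹ * d 2 : (LocalRing L v)ˣ) : LocalRing L v) w - 1) := by
    haveI := PlacesOver.subsingleton_of_smul_eq (IsCMField.complexConj L) (IsCMField.complexConj_ne_one L) w hw
    rw [Fintype.prod_subsingleton _ w, Pi.sub_apply, Pi.one_apply]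
  rw [key, hδ, hPA, hPB, unitModulusChar_eq_normAbs L v w hw]

/-- **ONE-PLACE CLOSED FORM OF VAN DIJK'S WEIGHT AT A REGULAR TORUS ELEMENT: `Δ(t) = |d₀|_w · ((|a − 1|_w · √|b − 1|_w)⁻¹)⁻¹`** (non-split `v`, the one
place `w ∣ v`; `dᵢ = torusEntry i t`, `a = d₀⁻¹d₁`, `b = d₀⁻¹d₂` with `a − 1`, `b − 1` units): LH6-p01's `dite` opened by ★ `vanDijkWeight_eq_of_isUnit` and read by
`weightTokens_eq_normAbs` on the diagonal writing `torusEntry · t`. [cite: Rogawski1990, §12.7 L. 12.7.2 (proof) p. 193; §4.9 (4.9.4) p. 56] [cite: vanDijk1972, Thm. p. 237] -/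
theorem vanDijkWeight_eq_of_isUnit_normAbs (w : PlacesOver L v) (hw : IsCMField.complexConj L • w.1 = w.1) (t : ↥(cmBorelTriple L 3 v).M)
    (ha : IsUnit ((((torusEntry (conjLocal L (IsCMField.complexConj L) v) (cmLocalForm L 3 v) 0 t)⁻¹ *
        torusEntry (conjLocal L (IsCMField.complexConj L) v) (cmLocalForm L 3 v) 1 t : (LocalRing L v)ˣ) : LocalRing L v) - 1))
    (hb : IsUnit ((((torusEntry (conjLocal L (IsCMField.complexConj L) v) (cmLocalForm L 3 v) 0 t)⁻¹ *
        torusEntry (conjLocal L (IsCMField.complexConj L) v) (cmLocalForm L 3 v) 2 t : (LocalRing L v)ˣ) : LocalRing L v) - 1)) :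
    vanDijkWeight L v t =
      (((normAbs (w.1.adicCompletion L) ((torusEntry (conjLocal L (IsCMField.complexConj L) v) (cmLocalForm L 3 v) 0 t : LocalRing L v) w) : ℝ≥0) : ℝ) : ℂ) *
        ((((normAbs (w.1.adicCompletion L)
              ((((torusEntry (conjLocal L (IsCMField.complexConj L) v) (cmLocalForm L 3 v) 0 t)⁻¹ *
                torusEntry (conjLocal L (IsCMField.complexConj L) v) (cmLocalForm L 3 v) 1 t : (LocalRing L v)ˣ) : LocalRing L v) w - 1) *
            NNReal.sqrt (normAbs (w.1.adicCompletion L)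
              ((((torusEntry (conjLocal L (IsCMField.complexConj L) v) (cmLocalForm L 3 v) 0 t)⁻¹ *
                torusEntry (conjLocal L (IsCMField.complexConj L) v) (cmLocalForm L 3 v) 2 t : (LocalRing L v)ˣ) : LocalRing L v) w - 1)))⁻¹ : ℝ≥0) : ℝ) : ℂ)⁻¹ := by
  rw [F0P3cStCharTSVanDijkWeylSymm.vanDijkWeight_eq_of_isUnit L v t ha hb]
  exact weightTokens_eq_normAbs L v w hw t _ (glDiagonal_torusEntry L v t) ha hb

include hns in
/-- **VAN DIJK'S WEIGHT ON THE SHELLS: `Δ(ι(α, z)) = max(‖α‖, ‖α‖⁻¹)` for `(α, z) ∉ M_c`** (non-split `v`; `‖·‖ = unitModulusChar (LocalRing L v)`; the value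
`((· : ℝ≥0) : ℂ)` is the composite cast through `ℝ`).  With `q = ‖α‖ ≠ 1`: `Δ = δ_B^{1∕2} · ‖a − 1‖ · √‖b − 1‖ = q · max(q⁻¹, 1) · √max(q⁻², 1) = max(q, q⁻¹)`
(§2 and `vanDijkWeight_eq_of_isUnit_normAbs`).  Print: `Δ(m) = |D_G(m)|` on `M − M_c`. [cite: Rogawski1990, §12.7 L. 12.7.2 (proof) p. 193; §4.9 (4.9.4) p. 56;
§12.2 p. 173] [cite: vanDijk1972, Thm. p. 237] -/
theorem vanDijkWeight_torusChart_of_not_mem (m : (LocalRing L v)ˣ × ↥(normOneUnits (conjLocal L (IsCMField.complexConj L) v)))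
    (hm : m ∉ (((Submonoid.pi Set.univ (fun w : PlacesOver L v => (w.1.adicCompletionIntegers L).toSubring.toSubmonoid)).units.prod (⊤ : Subgroup ↥(normOneUnits (conjLocal L (IsCMField.complexConj L) v)))) : Subgroup ((LocalRing L v)ˣ × ↥(normOneUnits (conjLocal L (IsCMField.complexConj L) v))))) :
    vanDijkWeight L v (torusChart L v m) =
      (((max (unitModulusChar (LocalRing L v) m.1) (unitModulusChar (LocalRing L v) m.1)⁻¹ : ℝ≥0) : ℝ) : ℂ) := by
  obtain ⟨w⟩ : Nonempty (PlacesOver L v) := inferInstance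
  obtain ⟨ha, hb⟩ := isUnit_regularScalars_torusChart_of_not_mem L v hns m hm
  have hq1 : normAbs (w.1.adicCompletion L) ((m.1 : LocalRing L v) w) ≠ 1 := by
    rw [← unitModulusChar_eq_normAbs L v w (hns w)]; exact (not_mem_torusCompactPart_iff L v w (hns w) m).1 hm
  have hq := normAbs_apply_ne_zero L v w m.1
  have hA1 : normAbs (w.1.adicCompletion L)
      ((((torusEntry (conjLocal L (IsCMField.complexConj L) v) (cmLocalForm L 3 v) 0 (torusChart L v m))⁻¹ *
        torusEntry (conjLocal L (IsCMField.complexConj L) v) (cmLocalForm L 3 v) 1 (torusChart L v m) : (LocalRing L v)ˣ) : LocalRing L v) w) ≠ 1 := by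
    rw [normAbs_regularScalar_fst L v hns w m]; exact inv_ne_one_of_ne_one hq1
  have hB1 : normAbs (w.1.adicCompletion L)
      ((((torusEntry (conjLocal L (IsCMField.complexConj L) v) (cmLocalForm L 3 v) 0 (torusChart L v m))⁻¹ *
        torusEntry (conjLocal L (IsCMField.complexConj L) v) (cmLocalForm L 3 v) 2 (torusChart L v m) : (LocalRing L v)ˣ) : LocalRing L v) w) ≠ 1 := by
    rw [normAbs_regularScalar_snd L v hns w m]; exact inv_mul_inv_ne_one_of_ne_one hq1
  rw [vanDijkWeight_eq_of_isUnit_normAbs L v w (hns w) (torusChart L v m) ha hb, normAbs_sub_one_eq_max hA1, normAbs_sub_one_eq_max hB1,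
    normAbs_regularScalar_fst L v hns w m, normAbs_regularScalar_snd L v hns w m, sqrt_max_inv_mul_inv_one, torusEntry_zero_torusChart,
    unitModulusChar_eq_normAbs L v w (hns w)]
  exact shellWeight_scalar_aux _ hq

include hns in
/-- **`Δ ∘ ι` IS CONSTANT ON THE SHELLS `m₀ · M_c` OFF `M_c`**: `Δ(ι(m₀ u)) = Δ(ι m₀)` for `m₀ ∉ M_c`, `u ∈ M_c` (`‖α₀ β‖ = ‖α₀‖` for `β ∈ 𝒪ˣ`,
★ `unitModulusChar_eq_one_of_forall_v_eq_one`). [cite: Rogawski1990, §12.7 L. 12.7.2 (proof) p. 193; §12.2 p. 173] -/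
theorem vanDijkWeight_torusChart_mul_of_mem (m₀ : (LocalRing L v)ˣ × ↥(normOneUnits (conjLocal L (IsCMField.complexConj L) v)))
    (hm₀ : m₀ ∉ (((Submonoid.pi Set.univ (fun w : PlacesOver L v => (w.1.adicCompletionIntegers L).toSubring.toSubmonoid)).units.prod (⊤ : Subgroup ↥(normOneUnits (conjLocal L (IsCMField.complexConj L) v)))) : Subgroup ((LocalRing L v)ˣ × ↥(normOneUnits (conjLocal L (IsCMField.complexConj L) v)))))
    (u : (LocalRing L v)ˣ × ↥(normOneUnits (conjLocal L (IsCMField.complexConj L) v)))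
    (hu : u ∈ (((Submonoid.pi Set.univ (fun w : PlacesOver L v => (w.1.adicCompletionIntegers L).toSubring.toSubmonoid)).units.prod (⊤ : Subgroup ↥(normOneUnits (conjLocal L (IsCMField.complexConj L) v)))) : Subgroup ((LocalRing L v)ˣ × ↥(normOneUnits (conjLocal L (IsCMField.complexConj L) v))))) :
    vanDijkWeight L v (torusChart L v (m₀ * u)) = vanDijkWeight L v (torusChart L v m₀) := by
  have hm : m₀ * u ∉ (((Submonoid.pi Set.univ (fun w : PlacesOver L v => (w.1.adicCompletionIntegers L).toSubring.toSubmonoid)).units.prod (⊤ : Subgroup ↥(normOneUnits (conjLocal L (IsCMField.complexConj L) v)))) : Subgroup ((LocalRing L v)ˣ × ↥(normOneUnits (conjLocal L (IsCMField.complexConj L) v)))) := by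
    intro h
    have h' := Subgroup.mul_mem _ h (Subgroup.inv_mem _ hu)
    rw [mul_inv_cancel_right] at h'
    exact hm₀ h'
  have hu1 : unitModulusChar (LocalRing L v) u.1 = 1 :=
    unitModulusChar_eq_one_of_forall_v_eq_one L v u.1 ((mem_unitsIntegers_iff L v u.1).1 (Subgroup.mem_prod.1 hu).1)
  rw [vanDijkWeight_torusChart_of_not_mem L v hns _ hm, vanDijkWeight_torusChart_of_not_mem L v hns _ hm₀, Prod.fst_mul, map_mul, hu1, mul_one]

include hns in
/-- **`Δ(ι m) ≠ 0` OFF `M_c`** (indeed `Δ(ι m) = max(‖α‖, ‖α‖⁻¹) ≥ 1`). [cite: Rogawski1990, §12.7 L. 12.7.2 (proof) p. 193; §12.5 p. 182] -/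
theorem vanDijkWeight_torusChart_ne_zero (m : (LocalRing L v)ˣ × ↥(normOneUnits (conjLocal L (IsCMField.complexConj L) v)))
    (hm : m ∉ (((Submonoid.pi Set.univ (fun w : PlacesOver L v => (w.1.adicCompletionIntegers L).toSubring.toSubmonoid)).units.prod (⊤ : Subgroup ↥(normOneUnits (conjLocal L (IsCMField.complexConj L) v)))) : Subgroup ((LocalRing L v)ˣ × ↥(normOneUnits (conjLocal L (IsCMField.complexConj L) v))))) :
    vanDijkWeight L v (torusChart L v m) ≠ 0 := by
  obtain ⟨w⟩ : Nonempty (PlacesOver L v) := inferInstance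
  rw [vanDijkWeight_torusChart_of_not_mem L v hns m hm, Complex.ofReal_ne_zero, NNReal.coe_ne_zero]
  have hq : unitModulusChar (LocalRing L v) m.1 ≠ 0 := by
    rw [unitModulusChar_eq_normAbs L v w (hns w)]; exact normAbs_apply_ne_zero L v w m.1
  exact (lt_max_of_lt_left (pos_iff_ne_zero.2 hq)).ne'

include hns in
/-- **`1 ≤ Δ(ι m)` OFF `M_c`** (the real value `max(‖α‖, ‖α‖⁻¹)`), a quantitative form of `vanDijkWeight_torusChart_ne_zero`. [cite: Rogawski1990, §12.7 L. 12.7.2 (proof) p. 193] -/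
theorem one_le_vanDijkWeight_torusChart_re (m : (LocalRing L v)ˣ × ↥(normOneUnits (conjLocal L (IsCMField.complexConj L) v)))
    (hm : m ∉ (((Submonoid.pi Set.univ (fun w : PlacesOver L v => (w.1.adicCompletionIntegers L).toSubring.toSubmonoid)).units.prod (⊤ : Subgroup ↥(normOneUnits (conjLocal L (IsCMField.complexConj L) v)))) : Subgroup ((LocalRing L v)ˣ × ↥(normOneUnits (conjLocal L (IsCMField.complexConj L) v))))) :
    1 ≤ (vanDijkWeight L v (torusChart L v m)).re := by
  obtain ⟨w⟩ : Nonempty (PlacesOver L v) := inferInstance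
  rw [vanDijkWeight_torusChart_of_not_mem L v hns m hm, Complex.ofReal_re, ← NNReal.coe_one, NNReal.coe_le_coe]
  have hq : unitModulusChar (LocalRing L v) m.1 ≠ 0 := by
    rw [unitModulusChar_eq_normAbs L v w (hns w)]; exact normAbs_apply_ne_zero L v w m.1
  rcases le_total 1 (unitModulusChar (LocalRing L v) m.1) with h | h
  · exact h.trans (le_max_left _ _)
  · exact ((one_le_inv₀ (pos_iff_ne_zero.2 hq)).2 h).trans (le_max_right _ _)
end CM

end Summit.HodgeConjecture.HodgeConjecture.Cruxes.H413.F0P3cStCharTSShellWeight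

end
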